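import Mathlib
import Literature.NumberTheory.LFunctions.Zhang2022.SkeletonAssembly
import Literature.NumberTheory.LFunctions.Zhang2022.SkeletonMeanValue
import HarnessLib

/-!
# Zhang (2022), typed skeleton X: the "By Lemma 8.1" reductions (8.7), (9.1), (10.1), (18.3),
# kernel-checked

Topic `Literature/NumberTheory/LFunctions/Zhang2022` (Landau–Siegel audit tree; verdict-neutral).
Y. Zhang, *Discrete mean estimates and the Landau–Siegel zero*, arXiv:2211.02515v1 (2022)
[Zhang2022LandauSiegel] — **an unrefereed manuscript under adjudication; nothing here asserts any of
its claims.** This file turns two of the skeleton's "By Lemma 8.1" nodes from CLAIMS into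
kernel-checked EDGES:

* `Apoly_a11_eq_H1` — **(8.8)**: with `𝐚₁₁(n) = χ(n)(ϰ₁(n) + ι₂ϰ₂(n))`, `A(𝐚₁₁;s,ψ) = H₁(s,ψ)`
  (the supports `n < P₁`, `n < P₂` sit inside the range `n < PT⁻²` of (7.2) once `𝓛 ≥ 2`);
  `ApolyBar_a21_eq_conj_H1` — `A(𝐚₂₁;1−ρ,ψ̄) = conj H₁(ρ,ψ)` on the critical line (`χ` real,
  `ψ̄ = ψ⁻¹`, `conj n^{−ρ} = n^{−(1−ρ)}` for `Re ρ = 1/2`); likewise for `𝐚₁₂, 𝐚₂₂` and `H₂`;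
* `adm72_a11`, `adm72_a21`, `adm72_a12`, `adm72_a22` — the sequences satisfy (7.2) with the bound
  `1 + |ι₂|` resp. `|ι₃| + |ι₄|` (`|ϰᵢ(n)| ≤ 1`: `β₆, β₇` are purely imaginary);
* `eq87_of` — **(8.7) "By Lemma 8.1, `Ξ₁₁ = 2Re{Θ₁(𝐚₁₁,𝐚₂₁)} + o(𝓟)`"**: `Prop22i → Lemma23 c′ →
  Lemma81 c′ → Eq87 c′` (at a zero on the line, `𝔠*` and `ω` are real, `|H₁|² = H₁·conj H₁`, and
  `conj 𝐚₂₁ = 𝐚₁₁` makes the reflected term the conjugate of the first);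
* `eq91_of` — **(9.1)** likewise: `Prop22i → Lemma23 c′ → Lemma81 c′ → Eq91 c′`;
* `J1_eq_sum`, `J2_eq_sum`, `Apoly_a13_eq_J1`, `Apoly_a14_eq_J2`, `ApolyBar_a13_eq_conj_J1` —
  `J₁, J₂` ((2.29)–(2.30), typed as finitely supported sums) are the polynomials `A(𝐚₁₃;·)`,
  `A(𝐚₁₄;·)` of §10 p. 20 (for `𝓛 ≥ 5`, where `α̃ ≤ 0.004`, `alphaTilde_le`), with (7.2)
  (`adm72_a13/a14/a23`, `|f̃| ≤ 1`);
* `eq101_of` — **(10.1)**: `Prop22i → Lemma23 c′ → Lemma81 c′ → Eq101 c′` (Lemma 8.1 twice: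
  `Ξ₁* = [lhs at (𝐚₁₁,𝐚₁₃)] + [lhs at (𝐚₁₄,𝐚₂₂)]`, `xiStar1_eq_lhs81`);
* `eq183_of` — **(18.3)**: `Prop22i → Lemma23 c′ → Lemma81 c′ → Eq183 c′`.

So in the DAG of `SkeletonPartTwo` the four "By Lemma 8.1" nodes `Eq87`, `Eq91`, `Eq101`, `Eq183`
are no longer hypotheses once `Prop22i`, `Lemma23`, `Lemma81` are granted.

## References

* Y. Zhang, arXiv:2211.02515v1 (2022), §2 (2.28)–(2.30), §7 (7.2), §8 (8.7)–(8.8), §9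
  (9.1)–(9.2), §10 (10.1), §18 (18.3). [cite: Zhang2022LandauSiegel, §§8–10, 18]
-/

noncomputable section

open Complex Real ComplexConjugate

namespace Literature.NumberTheory.LFunctions.Zhang2022.Skeleton

/-! ## Sizes: the supports of `ϰ₁, ϰ₂, ϰ₃` sit inside the range of (7.2) -/

section Sizes

variable (D : ℕ)

/-- `P ≥ 1` and `T ≥ 1`. [cite: Zhang2022LandauSiegel, §2 (2.6)] -/
private theorem one_le_bigP : 1 ≤ bigP D := Real.one_le_exp (by rw [ell]; positivity)

/-- For `𝓛 ≥ 2`: `P₁ = P^{0.504} < PT⁻²` (`2𝓛^{1.1} < 0.496𝓛⁹`). [cite: Zhang2022LandauSiegel, §2 (2.21), §7 (7.2)] -/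
theorem P1_lt_P_div_T_sq (hD : 2 ≤ Real.log D) : P1 D < bigP D / bigT D ^ 2 := by
  have hℓ : 2 ≤ ell D := by rw [ell]; exact hD
  have h1 : (1 : ℝ) ≤ ell D := by linarith
  rw [P1, bigP, bigT, ← Real.exp_mul, ← Real.exp_nat_mul, ← Real.exp_sub, Real.exp_lt_exp]
  have h11 : ell D ^ (1.1 : ℝ) ≤ ell D ^ (2 : ℝ) :=
    Real.rpow_le_rpow_of_exponent_le h1 (by norm_num)
  rw [Real.rpow_two] at h11
  push_cast
  nlinarith [pow_le_pow_left₀ (by linarith : (0 : ℝ) ≤ 2) hℓ 7, pow_pos (by linarith : (0:ℝ) < ell D) 2,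
    mul_le_mul_of_nonneg_left (pow_le_pow_left₀ (by linarith : (0 : ℝ) ≤ 2) hℓ 7) (pow_nonneg (by linarith : (0:ℝ) ≤ ell D) 2),
    show ell D ^ 9 = ell D ^ 2 * ell D ^ 7 by ring]

/-- For `𝓛 ≥ 2`: `P₁ ≤ PT⁻²`. [cite: Zhang2022LandauSiegel, §2 (2.21), §7 (7.2)] -/
theorem P1_le_P_div_T_sq (hD : 2 ≤ Real.log D) : P1 D ≤ bigP D / bigT D ^ 2 :=
  (P1_lt_P_div_T_sq D hD).le

/-- `P₂ ≤ P₁` and `P₃ ≤ P₁`. [cite: Zhang2022LandauSiegel, §2 (2.21)] -/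
theorem P2_le_P1 : P2 D ≤ P1 D := by
  have hP := one_le_bigP D
  have hT : 1 ≤ bigT D := Real.one_le_exp (Real.rpow_nonneg (by rw [ell]; positivity) _)
  rw [P2, P1]
  calc bigP D ^ (0.5 : ℝ) / bigT D ^ 10 ≤ bigP D ^ (0.5 : ℝ) := by
        apply div_le_self (by positivity) (one_le_pow₀ hT)
    _ ≤ bigP D ^ (0.504 : ℝ) := Real.rpow_le_rpow_of_exponent_le hP (by norm_num)

/-- `P₃ ≤ P₁`. [cite: Zhang2022LandauSiegel, §2 (2.21)] -/
theorem P3_le_P1 : P3 D ≤ P1 D := by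
  rw [P3, P1]; exact Real.rpow_le_rpow_of_exponent_le (one_le_bigP D) (by norm_num)

/-- For `𝓛 ≥ 2`: `⌈P₁⌉ ≤ ⌈PT⁻²⌉`, the truncation of `A(𝐚;s,ψ)`. [cite: Zhang2022LandauSiegel, §7 (7.2)] -/
theorem ceil_P1_le_Nsupp (hD : 2 ≤ Real.log D) : ⌈P1 D⌉₊ ≤ Nsupp D :=
  Nat.ceil_mono (P1_le_P_div_T_sq D hD)

end Sizes

/-! ## The sequences `𝐚₁₁, 𝐚₂₁, 𝐚₁₂, 𝐚₂₂` and the polynomials `H₁, H₂` -/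

section Polys

variable {D : ℕ} (χ : DirichletCharacter ℂ D) (x : Chr D)

/-- `ψχ(0) = 0`. [folklore] -/
private theorem pc_zero : pc χ x 0 = 0 := by
  haveI : Fact (1 < x.p) := ⟨x.prime.one_lt⟩
  rw [pc, Nat.cast_zero, Nat.cast_zero, MulChar.map_zero, zero_mul]

/-- `ϰ₁(n) = 0` for `n ≥ P₁`. [cite: Zhang2022LandauSiegel, §8 (8.6)] -/
theorem vk1_eq_zero {n : ℕ} (h : P1 D ≤ n) : vk1 D n = 0 := by rw [vk1, if_neg (not_lt.mpr h)]

/-- `ϰ₂(n) = 0` for `n ≥ P₂`. [cite: Zhang2022LandauSiegel, §8 (8.6)] -/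
theorem vk2_eq_zero {n : ℕ} (h : P2 D ≤ n) : vk2 D n = 0 := by rw [vk2, if_neg (not_lt.mpr h)]

/-- `ϰ₃(n) = 0` for `n ≥ P₃`. [cite: Zhang2022LandauSiegel, §8 (8.6)] -/
theorem vk3_eq_zero {n : ℕ} (h : P3 D ≤ n) : vk3 D n = 0 := by rw [vk3, if_neg (not_lt.mpr h)]

/-- A sum `Σ_{1 ≤ n < ⌈Q⌉} v(n)ψχ(n)n^{−s}` with `v` vanishing from `Q` on equals the same sum over
`0 ≤ n < N` for any `N ≥ ⌈Q⌉`. [cite: Zhang2022LandauSiegel, §7 p. 13] -/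
private theorem sum_Ico_eq_sum_range {Q : ℝ} {N : ℕ} (hN : ⌈Q⌉₊ ≤ N) (v : ℕ → ℂ)
    (hv : ∀ n : ℕ, Q ≤ n → v n = 0) (s : ℂ) :
    ∑ n ∈ Finset.Ico 1 ⌈Q⌉₊, v n * pc χ x n * (n : ℂ) ^ (-s) =
      ∑ n ∈ Finset.range N, v n * pc χ x n * (n : ℂ) ^ (-s) := by
  apply Finset.sum_subset
  · intro n hn
    rw [Finset.mem_Ico] at hn
    exact Finset.mem_range.mpr (lt_of_lt_of_le hn.2 hN)
  · intro n _ hn'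
    rw [Finset.mem_Ico, not_and_or, not_le, not_lt] at hn'
    rcases hn' with h0 | hP
    · have : n = 0 := by omega
      rw [this, pc_zero]; simp
    · rw [hv n (le_trans (Nat.le_ceil _) (by exact_mod_cast hP))]; simp

/-- **(8.8): `A(𝐚₁₁;s,ψ) = H₁(s,ψ)`** (for `𝓛 ≥ 2`, so that `P₁ ≤ PT⁻²`).
[cite: Zhang2022LandauSiegel, §8 (8.8)] -/
theorem Apoly_a11_eq_H1 (hD : 2 ≤ Real.log D) (s : ℂ) : Apoly x (a11 χ) s = H1 χ x s := by
  have h1 := ceil_P1_le_Nsupp D hD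
  have h2 : ⌈P2 D⌉₊ ≤ Nsupp D := le_trans (Nat.ceil_mono (P2_le_P1 D)) h1
  rw [Apoly, Lemma81.dirPoly_def, H1, H11, H12,
    sum_Ico_eq_sum_range χ x h1 (vk1 D) (fun n hn => vk1_eq_zero hn) s,
    sum_Ico_eq_sum_range χ x h2 (vk2 D) (fun n hn => vk2_eq_zero hn) s,
    Finset.mul_sum, ← Finset.sum_add_distrib]
  refine Finset.sum_congr rfl fun n _ => ?_
  simp only [a11, pc]
  ring

/-- **(9.2): `A(𝐚₁₂;s,ψ) = H₂(s,ψ)`** (for `𝓛 ≥ 2`). [cite: Zhang2022LandauSiegel, §9 (9.2)] -/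
theorem Apoly_a12_eq_H2 (hD : 2 ≤ Real.log D) (s : ℂ) : Apoly x (a12 χ) s = H2 χ x s := by
  have h1 := ceil_P1_le_Nsupp D hD
  have h2 : ⌈P2 D⌉₊ ≤ Nsupp D := le_trans (Nat.ceil_mono (P2_le_P1 D)) h1
  have h3 : ⌈P3 D⌉₊ ≤ Nsupp D := le_trans (Nat.ceil_mono (P3_le_P1 D)) h1
  rw [Apoly, Lemma81.dirPoly_def, H2, H13, H12,
    sum_Ico_eq_sum_range χ x h3 (vk3 D) (fun n hn => vk3_eq_zero hn) s,
    sum_Ico_eq_sum_range χ x h2 (vk2 D) (fun n hn => vk2_eq_zero hn) s,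
    Finset.mul_sum, Finset.mul_sum, ← Finset.sum_add_distrib]
  refine Finset.sum_congr rfl fun n _ => ?_
  simp only [a12, pc]
  ring

/-- `conj (n^m) = n^{conj m}` for a natural number `n`. [folklore] -/
private theorem conj_natCast_cpow (n : ℕ) (m : ℂ) : conj ((n : ℂ) ^ m) = (n : ℂ) ^ conj m := by
  have h := Complex.conj_cpow (n : ℂ) (conj m) (by rw [Complex.natCast_arg]; exact Real.pi_pos.ne)
  rw [Complex.conj_natCast, Complex.conj_conj] at h
  exact h.symm

/-- On the critical line `conj ρ = 1 − ρ`. [cite: Zhang2022LandauSiegel, §2 (2.12)] -/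
private theorem conj_eq_one_sub {ρ : ℂ} (hρ : ρ.re = 1 / 2) : conj ρ = 1 - ρ := by
  apply Complex.ext
  · simp [hρ]; norm_num
  · simp

/-- A real (quadratic) character is fixed by complex conjugation. [folklore] -/
private theorem conj_apply_of_isQuadratic (hq : χ.IsQuadratic) (a : ZMod D) :
    conj (χ a) = χ a := by
  rcases hq a with h | h | h <;> simp [h]

/-- `conj ψ(a) = ψ̄(a) = ψ⁻¹(a)`. [folklore] -/
private theorem conj_psi_apply (a : ZMod x.p) : conj (x.ψ a) = x.ψ⁻¹ a := by
  rw [← MulChar.star_apply']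
  rfl

/-- **`A(𝐚₂₁;1−ρ,ψ̄) = conj H₁(ρ,ψ)`** on the critical line (`𝐚₂₁ = conj 𝐚₁₁`, `χ` real, (2.12)).
[cite: Zhang2022LandauSiegel, §8 (8.7)–(8.8)] -/
theorem ApolyBar_a21_eq_conj_H1 (hD : 2 ≤ Real.log D) (hq : χ.IsQuadratic) {ρ : ℂ}
    (hρ : ρ.re = 1 / 2) : ApolyBar x (a21 χ) (1 - ρ) = conj (H1 χ x ρ) := by
  have h1 := ceil_P1_le_Nsupp D hD
  have h2 : ⌈P2 D⌉₊ ≤ Nsupp D := le_trans (Nat.ceil_mono (P2_le_P1 D)) h1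
  rw [ApolyBar, Lemma81.dirPoly_def, H1, H11, H12,
    sum_Ico_eq_sum_range χ x h1 (vk1 D) (fun n hn => vk1_eq_zero hn) ρ,
    sum_Ico_eq_sum_range χ x h2 (vk2 D) (fun n hn => vk2_eq_zero hn) ρ,
    map_add, map_mul, map_sum, map_sum, Finset.mul_sum, ← Finset.sum_add_distrib]
  refine Finset.sum_congr rfl fun n _ => ?_
  have hn : conj ((n : ℂ) ^ (-ρ)) = (n : ℂ) ^ (-(1 - ρ)) := by
    rw [conj_natCast_cpow, map_neg, conj_eq_one_sub hρ]
  simp only [a21, a11, pc, map_mul, map_add, hn, conj_apply_of_isQuadratic χ hq,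
    conj_psi_apply x]
  ring

/-- **`A(𝐚₂₂;1−ρ,ψ̄) = conj H₂(ρ,ψ)`** on the critical line (`𝐚₂₂ = conj 𝐚₁₂`, reading (9.2)'s
"`a₂₂ = conj a₂₁`" as the typo it is). [cite: Zhang2022LandauSiegel, §9 (9.1)–(9.2)] -/
theorem ApolyBar_a22_eq_conj_H2 (hD : 2 ≤ Real.log D) (hq : χ.IsQuadratic) {ρ : ℂ}
    (hρ : ρ.re = 1 / 2) : ApolyBar x (a22 χ) (1 - ρ) = conj (H2 χ x ρ) := by
  have h1 := ceil_P1_le_Nsupp D hD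
  have h2 : ⌈P2 D⌉₊ ≤ Nsupp D := le_trans (Nat.ceil_mono (P2_le_P1 D)) h1
  have h3 : ⌈P3 D⌉₊ ≤ Nsupp D := le_trans (Nat.ceil_mono (P3_le_P1 D)) h1
  rw [ApolyBar, Lemma81.dirPoly_def, H2, H13, H12,
    sum_Ico_eq_sum_range χ x h3 (vk3 D) (fun n hn => vk3_eq_zero hn) ρ,
    sum_Ico_eq_sum_range χ x h2 (vk2 D) (fun n hn => vk2_eq_zero hn) ρ,
    map_add, map_mul, map_mul, map_sum, map_sum, Finset.mul_sum, Finset.mul_sum,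
    ← Finset.sum_add_distrib]
  refine Finset.sum_congr rfl fun n _ => ?_
  have hn : conj ((n : ℂ) ^ (-ρ)) = (n : ℂ) ^ (-(1 - ρ)) := by
    rw [conj_natCast_cpow, map_neg, conj_eq_one_sub hρ]
  simp only [a22, a12, pc, map_mul, map_add, hn, conj_apply_of_isQuadratic χ hq,
    conj_psi_apply x, Complex.conj_conj]
  ring

end Polys

/-! ## The tent `f̃` and the polynomials `J₁, J₂` as `A(𝐚₁₃;·)`, `A(𝐚₁₄;·)` -/

section Tent

variable (D : ℕ)

/-- `f̃` vanishes off `[0.5, 0.504]`. [cite: Zhang2022LandauSiegel, §2 (2.28)] -/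
theorem ftilde_eq_zero {z : ℝ} (h : z < 0.5 ∨ 0.504 < z) : ftilde z = 0 := by
  rw [ftilde]
  rcases h with h | h
  · rw [if_neg (by intro h'; linarith [h'.1]), if_neg (by intro h'; linarith [h'.1])]
  · rw [if_neg (by intro h'; linarith [h'.2]), if_neg (by intro h'; linarith [h'.2])]

/-- `|f̃| ≤ 1`. [cite: Zhang2022LandauSiegel, §2 (2.28)] -/
theorem abs_ftilde_le_one (z : ℝ) : |ftilde z| ≤ 1 := by
  rw [ftilde, abs_le]
  split_ifs with h1 h2
  · constructor <;> nlinarith [h1.1, h1.2]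
  · constructor <;> nlinarith [h2.1, h2.2]
  · norm_num

/-- `log P = 𝓛⁹`. [cite: Zhang2022LandauSiegel, §2 (2.6)] -/
theorem log_bigP : Real.log (bigP D) = ell D ^ 9 := by rw [bigP, Real.log_exp]

/-- For `n > P₁` (and any shift `c ≥ 0`): `log n/log P + c > 0.504`, so `f̃` vanishes there.
[cite: Zhang2022LandauSiegel, §2 (2.29)] -/
theorem ftilde_log_eq_zero_of_P1_lt (hD : 2 ≤ Real.log D) {n : ℕ} (hn : P1 D < n) {c : ℝ}
    (hc : 0 ≤ c) : ftilde (Real.log n / Real.log (bigP D) + c) = 0 := by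
  have hℓ : 0 < ell D := by rw [ell]; linarith
  have hP1 : 0 < P1 D := Real.rpow_pos_of_pos (Real.exp_pos _) _
  have hP : 0 < bigP D := Real.exp_pos _
  have hlogP1 : Real.log (P1 D) = 0.504 * ell D ^ 9 := by
    rw [P1, Real.log_rpow hP, log_bigP]
  have hlt : 0.504 * ell D ^ 9 < Real.log n := by
    rw [← hlogP1]; exact Real.log_lt_log hP1 hn
  apply ftilde_eq_zero
  right
  rw [log_bigP]
  have h9 : 0 < ell D ^ 9 := by positivity
  have : 0.504 < Real.log n / ell D ^ 9 := by rw [lt_div_iff₀ h9]; linarith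
  linarith

/-- `α̃ = (𝓛 + 519 log 𝓛)/𝓛⁹ ≤ 0.004` once `𝓛 ≥ 5`. [cite: Zhang2022LandauSiegel, §2 (2.30)] -/
theorem alphaTilde_le (hD : 5 ≤ Real.log D) : alphaTilde D ≤ 0.004 := by
  have hℓ : 5 ≤ ell D := by rw [ell]; exact hD
  have hℓ0 : 0 < ell D := by linarith
  have hD0 : (0 : ℝ) < D := by
    rcases Nat.eq_zero_or_pos D with h | h
    · subst h; simp at hD; linarith
    · exact_mod_cast h
  have ht0 : 0 < t0 D := by rw [t0]; positivity
  rw [alphaTilde, log_bigP, Real.log_mul hD0.ne' ht0.ne', t0, Real.log_pow,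
    div_le_iff₀ (by positivity)]
  have hlog : Real.log (ell D) ≤ ell D := (Real.log_le_sub_one_of_pos hℓ0).trans (by linarith)
  have h8 : (5 : ℝ) ^ 8 ≤ ell D ^ 8 := pow_le_pow_left₀ (by norm_num) hℓ 8
  have hℓ' : Real.log (D : ℝ) = ell D := rfl
  rw [hℓ']
  push_cast
  nlinarith

/-- For `n > P₁` and `𝓛 ≥ 5`: `f̃(log n/log P + 0.004 − α̃) = 0` (the argument exceeds `0.504`).
[cite: Zhang2022LandauSiegel, §2 (2.30)] -/
theorem ftilde_log_shift_eq_zero_of_P1_lt (hD : 5 ≤ Real.log D) {n : ℕ} (hn : P1 D < n) :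
    ftilde (Real.log n / Real.log (bigP D) + 0.004 - alphaTilde D) = 0 := by
  rw [add_sub_assoc]
  exact ftilde_log_eq_zero_of_P1_lt D (by linarith) hn (by linarith [alphaTilde_le D hD])

/-- For `𝓛 ≥ 2` and `n ≥ ⌈PT⁻²⌉`: `n > P₁`. [cite: Zhang2022LandauSiegel, §7 (7.2)] -/
theorem P1_lt_of_Nsupp_le (hD : 2 ≤ Real.log D) {n : ℕ} (hn : Nsupp D ≤ n) : P1 D < n :=
  lt_of_lt_of_le (P1_lt_P_div_T_sq D hD) (le_trans (Nat.le_ceil _) (by exact_mod_cast hn))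

end Tent

section JPolys

variable {D : ℕ} (χ : DirichletCharacter ℂ D) (x : Chr D)

/-- **`J₁` is a finite sum over `n < ⌈PT⁻²⌉`** (for `𝓛 ≥ 2`): its summand vanishes for `n > P₁`.
[cite: Zhang2022LandauSiegel, §2 (2.29)] -/
theorem J1_eq_sum (hD : 2 ≤ Real.log D) (s : ℂ) :
    J1 χ x s = ∑ n ∈ Finset.range (Nsupp D),
      pc χ x n * (n : ℂ) ^ (-s) * (ftilde (Real.log n / Real.log (bigP D)) : ℂ) := by
  rw [J1]
  apply finsum_eq_sum_of_support_subset
  intro n hn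
  rw [Function.mem_support] at hn
  rw [Finset.coe_range, Set.mem_Iio]
  by_contra hge
  rw [not_lt] at hge
  apply hn
  have h0 := ftilde_log_eq_zero_of_P1_lt D hD (P1_lt_of_Nsupp_le D hD hge) le_rfl
  rw [add_zero] at h0
  rw [h0]
  simp

/-- **`J₂` is a finite sum over `n < ⌈PT⁻²⌉`** (for `𝓛 ≥ 5`). [cite: Zhang2022LandauSiegel, §2 (2.30)] -/
theorem J2_eq_sum (hD : 5 ≤ Real.log D) (s : ℂ) :
    J2 χ x s = ∑ n ∈ Finset.range (Nsupp D), pc χ x n * (n : ℂ) ^ (-s) *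
      (ftilde (Real.log n / Real.log (bigP D) + 0.004 - alphaTilde D) : ℂ) := by
  rw [J2]
  apply finsum_eq_sum_of_support_subset
  intro n hn
  rw [Function.mem_support] at hn
  rw [Finset.coe_range, Set.mem_Iio]
  by_contra hge
  rw [not_lt] at hge
  apply hn
  rw [ftilde_log_shift_eq_zero_of_P1_lt D hD (P1_lt_of_Nsupp_le D (by linarith) hge)]
  simp

/-- **`A(𝐚₁₃;s,ψ) = J₁(s,ψ)`** (§10 p. 20; for `𝓛 ≥ 2`). [cite: Zhang2022LandauSiegel, §10 (10.1)] -/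
theorem Apoly_a13_eq_J1 (hD : 2 ≤ Real.log D) (s : ℂ) : Apoly x (a13 χ) s = J1 χ x s := by
  rw [Apoly, Lemma81.dirPoly_def, J1_eq_sum χ x hD]
  refine Finset.sum_congr rfl fun n _ => ?_
  simp only [a13, pc]
  ring

/-- **`A(𝐚₁₄;s,ψ) = J₂(s,ψ)`** (§10 p. 20; for `𝓛 ≥ 5`). [cite: Zhang2022LandauSiegel, §10 (10.1)] -/
theorem Apoly_a14_eq_J2 (hD : 5 ≤ Real.log D) (s : ℂ) : Apoly x (a14 χ) s = J2 χ x s := by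
  rw [Apoly, Lemma81.dirPoly_def, J2_eq_sum χ x hD]
  refine Finset.sum_congr rfl fun n _ => ?_
  simp only [a14, pc]
  ring

/-- **`A(𝐚₁₃;1−ρ,ψ̄) = conj J₁(ρ,ψ)`** on the critical line (`𝐚₁₃` is real; `χ` real).
[cite: Zhang2022LandauSiegel, §10 (10.1)] -/
theorem ApolyBar_a13_eq_conj_J1 (hD : 2 ≤ Real.log D) (hq : χ.IsQuadratic) {ρ : ℂ}
    (hρ : ρ.re = 1 / 2) : ApolyBar x (a13 χ) (1 - ρ) = conj (J1 χ x ρ) := by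
  rw [ApolyBar, Lemma81.dirPoly_def, J1_eq_sum χ x hD, map_sum]
  refine Finset.sum_congr rfl fun n _ => ?_
  have hn : conj ((n : ℂ) ^ (-ρ)) = (n : ℂ) ^ (-(1 - ρ)) := by
    rw [conj_natCast_cpow, map_neg, conj_eq_one_sub hρ]
  simp only [a13, pc, map_mul, hn, conj_apply_of_isQuadratic χ hq, conj_psi_apply x,
    Complex.conj_ofReal]
  ring

/-- **`A(𝐚₂₃;1−ρ,ψ̄) = conj J₁(ρ,ψ)`** (`𝐚₂₃ = 𝐚₁₃`). [cite: Zhang2022LandauSiegel, §18 (18.3)] -/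
theorem ApolyBar_a23_eq_conj_J1 (hD : 2 ≤ Real.log D) (hq : χ.IsQuadratic) {ρ : ℂ}
    (hρ : ρ.re = 1 / 2) : ApolyBar x (a23 χ) (1 - ρ) = conj (J1 χ x ρ) :=
  ApolyBar_a13_eq_conj_J1 χ x hD hq hρ

end JPolys

/-! ## (7.2) for the four sequences -/

section Admissible

variable {D : ℕ} (χ : DirichletCharacter ℂ D)

/-- `|ϰ₁(n)| ≤ 1` (`β₆` is purely imaginary; `0 ≤ 1 − log n/log P₁ ≤ 1` for `1 ≤ n < P₁`).
[cite: Zhang2022LandauSiegel, §8 (8.6)] -/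
theorem norm_vk1_le (hD : 2 ≤ Real.log D) (n : ℕ) : ‖vk1 D n‖ ≤ 1 := by
  rw [vk1]
  split_ifs with h
  · rcases Nat.eq_zero_or_pos n with rfl | hn
    · have hb : beta6 D ≠ 0 := by
        rw [beta6]
        have hα : (alpha D : ℂ) ≠ 0 := by
          have : 0 < alpha D := by
            rw [alpha, bigP, Real.log_exp]; exact div_pos Real.pi_pos (by rw [ell]; positivity)
          exact_mod_cast this.ne'
        simp [hα, Complex.I_ne_zero]
      simp [Complex.zero_cpow hb]
    · have hP1 : 1 < P1 D := by
        rw [P1, bigP]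
        refine Real.one_lt_rpow ?_ (by norm_num)
        exact Real.one_lt_exp_iff.mpr (by rw [ell]; positivity)
      have hn' : (0 : ℝ) < n := by exact_mod_cast hn
      have hlogn : 0 ≤ Real.log n := Real.log_nonneg (by exact_mod_cast hn)
      have hlogP : 0 < Real.log (P1 D) := Real.log_pos hP1
      have hq : Real.log n / Real.log (P1 D) < 1 := by
        rw [div_lt_one hlogP]; exact Real.log_lt_log hn' h
      have h01 : 0 ≤ 1 - Real.log n / Real.log (P1 D) := by
        have : 0 ≤ Real.log n / Real.log (P1 D) := div_nonneg hlogn hlogP.le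
        linarith
      rw [norm_mul, Complex.norm_real, Real.norm_of_nonneg h01,
        Complex.norm_cpow_eq_rpow_re_of_pos (div_pos (by linarith) hn')]
      have : (beta6 D).re = 0 := by simp [beta6]
      rw [this, Real.rpow_zero, mul_one]
      have : 0 ≤ Real.log n / Real.log (P1 D) := div_nonneg hlogn hlogP.le
      linarith
  · simp

/-- `|ϰ₂(n)| ≤ 1`. [cite: Zhang2022LandauSiegel, §8 (8.6)] -/
theorem norm_vk2_le (hD : 2 ≤ Real.log D) (n : ℕ) : ‖vk2 D n‖ ≤ 1 := by
  rw [vk2]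
  split_ifs with h
  · rcases Nat.eq_zero_or_pos n with rfl | hn
    · have hb : beta7 D ≠ 0 := by
        rw [beta7]
        have hα : (alpha D : ℂ) ≠ 0 := by
          have : 0 < alpha D := by
            rw [alpha, bigP, Real.log_exp]; exact div_pos Real.pi_pos (by rw [ell]; positivity)
          exact_mod_cast this.ne'
        simp [hα, Complex.I_ne_zero]
      simp [Complex.zero_cpow hb]
    · have hn' : (0 : ℝ) < n := by exact_mod_cast hn
      have hP2 : 0 < P2 D := lt_of_lt_of_le' h hn'.le |>.trans_le' le_rfl
      have h1n : (1 : ℝ) ≤ n := by exact_mod_cast hn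
      have hP2' : 1 < P2 D := lt_of_le_of_lt h1n h
      have hlogn : 0 ≤ Real.log n := Real.log_nonneg h1n
      have hlogP : 0 < Real.log (P2 D) := Real.log_pos hP2'
      have h01 : 0 ≤ 1 - Real.log n / Real.log (P2 D) := by
        have : Real.log n / Real.log (P2 D) < 1 := by
          rw [div_lt_one hlogP]; exact Real.log_lt_log hn' h
        linarith
      rw [norm_mul, Complex.norm_real, Real.norm_of_nonneg h01,
        Complex.norm_cpow_eq_rpow_re_of_pos (div_pos (by linarith) hn')]
      have : (beta7 D).re = 0 := by simp [beta7]
      rw [this, Real.rpow_zero, mul_one]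
      have : 0 ≤ Real.log n / Real.log (P2 D) := div_nonneg hlogn hlogP.le
      linarith
  · simp

/-- `|ϰ₃(n)| ≤ 1`. [cite: Zhang2022LandauSiegel, §8 (8.6)] -/
theorem norm_vk3_le (hD : 2 ≤ Real.log D) (n : ℕ) : ‖vk3 D n‖ ≤ 1 := by
  rw [vk3]
  split_ifs with h
  · rcases Nat.eq_zero_or_pos n with rfl | hn
    · have hb : beta6 D ≠ 0 := by
        rw [beta6]
        have hα : (alpha D : ℂ) ≠ 0 := by
          have : 0 < alpha D := by
            rw [alpha, bigP, Real.log_exp]; exact div_pos Real.pi_pos (by rw [ell]; positivity)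
          exact_mod_cast this.ne'
        simp [hα, Complex.I_ne_zero]
      simp [Complex.zero_cpow hb]
    · have hn' : (0 : ℝ) < n := by exact_mod_cast hn
      have h1n : (1 : ℝ) ≤ n := by exact_mod_cast hn
      have hP3' : 1 < P3 D := lt_of_le_of_lt h1n h
      have hlogn : 0 ≤ Real.log n := Real.log_nonneg h1n
      have hlogP : 0 < Real.log (P3 D) := Real.log_pos hP3'
      have h01 : 0 ≤ 1 - Real.log n / Real.log (P3 D) := by
        have : Real.log n / Real.log (P3 D) < 1 := by
          rw [div_lt_one hlogP]; exact Real.log_lt_log hn' h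
        linarith
      rw [norm_mul, Complex.norm_real, Real.norm_of_nonneg h01,
        Complex.norm_cpow_eq_rpow_re_of_pos (div_pos (by linarith) hn')]
      have : (beta6 D).re = 0 := by simp [beta6]
      rw [this, Real.rpow_zero, mul_one]
      have : 0 ≤ Real.log n / Real.log (P3 D) := div_nonneg hlogn hlogP.le
      linarith
  · simp

/-- `|χ(n)| ≤ 1`. [folklore] -/
private theorem norm_chi_le (n : ℕ) : ‖χ (n : ZMod D)‖ ≤ 1 := DirichletCharacter.norm_le_one χ _

/-- (7.2) with a bound `B` implies (7.2) with any larger bound. [cite: Zhang2022LandauSiegel, §7 (7.2)] -/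
theorem adm72_mono {B B' : ℝ} (hBB' : B ≤ B') {a : ℕ → ℂ} (h : Adm72 D B a) : Adm72 D B' a :=
  ⟨fun n => (h.1 n).trans hBB', h.2⟩

/-- **`𝐚₁₁` satisfies (7.2)** with the bound `1 + |ι₂|` (for `𝓛 ≥ 2`).
[cite: Zhang2022LandauSiegel, §7 (7.2), §8 (8.8)] -/
theorem adm72_a11 (hD : 2 ≤ Real.log D) : Adm72 D (1 + ‖iota2‖) (a11 χ) := by
  refine ⟨fun n => ?_, fun n hn => ?_⟩
  · rw [a11, norm_mul]
    calc ‖χ (n : ZMod D)‖ * ‖vk1 D n + iota2 * vk2 D n‖ ≤ 1 * (‖vk1 D n‖ + ‖iota2‖ * ‖vk2 D n‖) := by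
          gcongr
          · exact norm_chi_le χ n
          · exact (norm_add_le _ _).trans (by rw [norm_mul])
      _ ≤ 1 * (1 + ‖iota2‖ * 1) := by
          gcongr
          · exact norm_vk1_le hD n
          · exact norm_vk2_le hD n
      _ = 1 + ‖iota2‖ := by ring
  · have h1 : P1 D ≤ n := le_trans (P1_le_P_div_T_sq D hD) hn
    rw [a11, vk1_eq_zero h1, vk2_eq_zero (le_trans (P2_le_P1 D) h1)]
    simp

/-- **`𝐚₂₁ = conj 𝐚₁₁` satisfies (7.2)** with the same bound. [cite: Zhang2022LandauSiegel, §7 (7.2), §8 (8.8)] -/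
theorem adm72_a21 (hD : 2 ≤ Real.log D) : Adm72 D (1 + ‖iota2‖) (a21 χ) := by
  obtain ⟨hb, hs⟩ := adm72_a11 χ hD
  refine ⟨fun n => ?_, fun n hn => ?_⟩
  · rw [a21, Complex.norm_conj]; exact hb n
  · rw [a21, hs n hn, map_zero]

/-- **`𝐚₁₂` satisfies (7.2)** with the bound `|ι₃| + |ι₄|` (for `𝓛 ≥ 2`).
[cite: Zhang2022LandauSiegel, §7 (7.2), §9 (9.2)] -/
theorem adm72_a12 (hD : 2 ≤ Real.log D) : Adm72 D (‖iota3‖ + ‖iota4‖) (a12 χ) := by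
  refine ⟨fun n => ?_, fun n hn => ?_⟩
  · rw [a12, norm_mul]
    calc ‖χ (n : ZMod D)‖ * ‖conj iota3 * vk3 D n + conj iota4 * vk2 D n‖
        ≤ 1 * (‖iota3‖ * ‖vk3 D n‖ + ‖iota4‖ * ‖vk2 D n‖) := by
          gcongr
          · exact norm_chi_le χ n
          · refine (norm_add_le _ _).trans ?_
            rw [norm_mul, norm_mul, Complex.norm_conj, Complex.norm_conj]
      _ ≤ 1 * (‖iota3‖ * 1 + ‖iota4‖ * 1) := by
          gcongr
          · exact norm_vk3_le hD n
          · exact norm_vk2_le hD n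
      _ = ‖iota3‖ + ‖iota4‖ := by ring
  · have h1 : P1 D ≤ n := le_trans (P1_le_P_div_T_sq D hD) hn
    rw [a12, vk3_eq_zero (le_trans (P3_le_P1 D) h1), vk2_eq_zero (le_trans (P2_le_P1 D) h1)]
    simp

/-- **`𝐚₂₂ = conj 𝐚₁₂` satisfies (7.2)** with the same bound. [cite: Zhang2022LandauSiegel, §7 (7.2), §9 (9.2)] -/
theorem adm72_a22 (hD : 2 ≤ Real.log D) : Adm72 D (‖iota3‖ + ‖iota4‖) (a22 χ) := by
  obtain ⟨hb, hs⟩ := adm72_a12 χ hD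
  refine ⟨fun n => ?_, fun n hn => ?_⟩
  · rw [a22, Complex.norm_conj]; exact hb n
  · rw [a22, hs n hn, map_zero]

/-- **`𝐚₁₃` satisfies (7.2)** with the bound `1` (for `𝓛 ≥ 2`: `0 ≤ f̃ ≤ 1`, support `≤ P₁ < PT⁻²`).
[cite: Zhang2022LandauSiegel, §7 (7.2), §10 p. 20] -/
theorem adm72_a13 (hD : 2 ≤ Real.log D) : Adm72 D 1 (a13 χ) := by
  refine ⟨fun n => ?_, fun n hn => ?_⟩
  · rw [a13, norm_mul, Complex.norm_real, Real.norm_eq_abs]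
    calc ‖χ (n : ZMod D)‖ * |ftilde (Real.log n / Real.log (bigP D))| ≤ 1 * 1 := by
          gcongr
          · exact norm_chi_le χ n
          · exact abs_ftilde_le_one _
      _ = 1 := by ring
  · have h := ftilde_log_eq_zero_of_P1_lt D hD (lt_of_lt_of_le (P1_lt_P_div_T_sq D hD) hn) le_rfl
    rw [add_zero] at h
    rw [a13, h]; simp

/-- **`𝐚₂₃ = 𝐚₁₃` satisfies (7.2)**. [cite: Zhang2022LandauSiegel, §7 (7.2), §18 (18.3)] -/
theorem adm72_a23 (hD : 2 ≤ Real.log D) : Adm72 D 1 (a23 χ) := adm72_a13 χ hD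

/-- **`𝐚₁₄` satisfies (7.2)** with the bound `1` (for `𝓛 ≥ 5`, so that `α̃ ≤ 0.004`).
[cite: Zhang2022LandauSiegel, §7 (7.2), §10 p. 20] -/
theorem adm72_a14 (hD : 5 ≤ Real.log D) : Adm72 D 1 (a14 χ) := by
  refine ⟨fun n => ?_, fun n hn => ?_⟩
  · rw [a14, norm_mul, Complex.norm_real, Real.norm_eq_abs]
    calc ‖χ (n : ZMod D)‖ * |ftilde (Real.log n / Real.log (bigP D) + 0.004 - alphaTilde D)|
          ≤ 1 * 1 := by
          gcongr
          · exact norm_chi_le χ n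
          · exact abs_ftilde_le_one _
      _ = 1 := by ring
  · have h := ftilde_log_shift_eq_zero_of_P1_lt D hD
      (lt_of_lt_of_le (P1_lt_P_div_T_sq D (by linarith)) hn)
    rw [a14, h]; simp

end Admissible

/-! ## (8.7) and (9.1) from Lemma 8.1 -/

section Reductions

variable {c' : ℝ}

/-- `log D ≥ 2` once `D ≥ 8`. [folklore] -/
private theorem two_le_log_of_eight_le {D : ℕ} (hD : 8 ≤ D) : 2 ≤ Real.log D := by
  have h8 : (8 : ℝ) ≤ D := by exact_mod_cast hD
  have h2 : (2 : ℝ) ≤ Real.log 8 := by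
    rw [Real.le_log_iff_exp_le (by norm_num)]
    have h1 := Real.exp_one_lt_d9
    have h0 := Real.exp_pos 1
    have hsq : Real.exp 2 = Real.exp 1 * Real.exp 1 := by rw [← Real.exp_add]; norm_num
    rw [hsq]
    nlinarith
  exact h2.trans (Real.log_le_log (by norm_num) h8)

/-- At a modulus where Prop. 2.2 (i) and Lemma 2.3 hold: `Ξ₁₁`, as a complex number, IS the left side
of Lemma 8.1 at `(𝐚₁₁, 𝐚₂₁)` — `𝔠*` and `ω` are real at the zeros, which lie on the line, and
`|H₁|² = H₁·conj H₁ = A(𝐚₁₁;ρ,ψ)A(𝐚₂₁;1−ρ,ψ̄)`. [cite: Zhang2022LandauSiegel, §8 (8.3), (8.7)] -/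
theorem xi11_eq_lhs81 {D : ℕ} [NeZero D] (χ : DirichletCharacter ℂ D) (hD : 8 ≤ D)
    (hq : χ.IsQuadratic)
    (h23 : ∀ x ∈ PsiOne χ, ∀ ρ ∈ zeroSet D x, (cstar c' D x ρ).im = 0 ∧ 0 ≤ (cstar c' D x ρ).re)
    (h22 : ∀ x ∈ PsiOne χ, ∀ s ∈ prodZeroSetOmega χ x, s.re = 1 / 2) :
    (xi11 c' χ : ℂ) = lhs81 c' χ (a11 χ) (a21 χ) := by
  have hD3 : 3 ≤ D := le_trans (by norm_num) hD
  have hlog := two_le_log_of_eight_le hD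
  rw [xi11, lhs81, Complex.ofReal_sum]
  refine Finset.sum_congr rfl fun i hi => ?_
  have mem : i.1 ∈ PsiOne χ ∧ i.2 ∈ zeroSet D i.1 := by
    rw [idx, Finset.mem_sigma] at hi
    exact ⟨mem_of_mem_finsetOf hi.1, mem_of_mem_finsetOf hi.2⟩
  have hre : i.2.re = 1 / 2 :=
    h22 i.1 mem.1 i.2 (mem_prodZeroSetOmega_of_mem_zeroSet χ mem.2)
  have hc := h23 i.1 mem.1 i.2 mem.2
  have hω := omegaW_re_pos hD3 hre
  have hcre : (((cstar c' D i.1 i.2).re : ℝ) : ℂ) = cstar c' D i.1 i.2 :=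
    Complex.ext rfl (by simp [hc.1])
  have hωre : (((omegaW D i.2).re : ℝ) : ℂ) = omegaW D i.2 :=
    Complex.ext rfl (by simp [hω.2])
  rw [Apoly_a11_eq_H1 χ i.1 hlog, ApolyBar_a21_eq_conj_H1 χ i.1 hlog hq hre]
  have hsq := Complex.mul_conj' (H1 χ i.1 i.2)
  push_cast at hsq ⊢
  rw [hcre, hωre, ← hsq]
  ring

/-- Likewise `Ξ₁₂ = [left side of Lemma 8.1 at (𝐚₁₂, 𝐚₂₂)]`. [cite: Zhang2022LandauSiegel, §8 (8.4), §9 (9.1)] -/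
theorem xi12_eq_lhs81 {D : ℕ} [NeZero D] (χ : DirichletCharacter ℂ D) (hD : 8 ≤ D)
    (hq : χ.IsQuadratic)
    (h23 : ∀ x ∈ PsiOne χ, ∀ ρ ∈ zeroSet D x, (cstar c' D x ρ).im = 0 ∧ 0 ≤ (cstar c' D x ρ).re)
    (h22 : ∀ x ∈ PsiOne χ, ∀ s ∈ prodZeroSetOmega χ x, s.re = 1 / 2) :
    (xi12 c' χ : ℂ) = lhs81 c' χ (a12 χ) (a22 χ) := by
  have hD3 : 3 ≤ D := le_trans (by norm_num) hD
  have hlog := two_le_log_of_eight_le hD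
  rw [xi12, lhs81, Complex.ofReal_sum]
  refine Finset.sum_congr rfl fun i hi => ?_
  have mem : i.1 ∈ PsiOne χ ∧ i.2 ∈ zeroSet D i.1 := by
    rw [idx, Finset.mem_sigma] at hi
    exact ⟨mem_of_mem_finsetOf hi.1, mem_of_mem_finsetOf hi.2⟩
  have hre : i.2.re = 1 / 2 :=
    h22 i.1 mem.1 i.2 (mem_prodZeroSetOmega_of_mem_zeroSet χ mem.2)
  have hc := h23 i.1 mem.1 i.2 mem.2
  have hω := omegaW_re_pos hD3 hre
  have hcre : (((cstar c' D i.1 i.2).re : ℝ) : ℂ) = cstar c' D i.1 i.2 :=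
    Complex.ext rfl (by simp [hc.1])
  have hωre : (((omegaW D i.2).re : ℝ) : ℂ) = omegaW D i.2 :=
    Complex.ext rfl (by simp [hω.2])
  rw [Apoly_a12_eq_H2 χ i.1 hlog, ApolyBar_a22_eq_conj_H2 χ i.1 hlog hq hre]
  have hsq := Complex.mul_conj' (H2 χ i.1 i.2)
  push_cast at hsq ⊢
  rw [hcre, hωre, ← hsq]
  ring

/-- **(8.7): "By Lemma 8.1, `Ξ₁₁ = 2Re{Θ₁(𝐚₁₁,𝐚₂₁)} + o(𝓟)`"** — the node `Eq87` FOLLOWS from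
Prop. 2.2 (i), Lemma 2.3 and Lemma 8.1 (kernel-checked): Lemma 8.1 at `(𝐚₁₁,𝐚₂₁)` (admissible by
`adm72_a11/a21`), `xi11_eq_lhs81`, and `conj 𝐚₂₁ = 𝐚₁₁` (so the reflected term
`conj Θ₁(conj 𝐚₂₁, conj 𝐚₁₁)` is `conj Θ₁(𝐚₁₁,𝐚₂₁)`). [cite: Zhang2022LandauSiegel, §8 (8.7)] -/
theorem eq87_of (h22 : Prop22i) (h23 : Lemma23 c') (h81 : Lemma81 c') : Eq87 c' := by
  intro ε hε
  obtain ⟨D₀, h⟩ := (h22.and h23).and (h81 (1 + ‖iota2‖) ε hε)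
  refine ⟨max D₀ 8, fun D _ χ hD hq hp hA => ?_⟩
  have hD8 : 8 ≤ D := le_trans (le_max_right _ _) hD
  have hlog := two_le_log_of_eight_le hD8
  obtain ⟨⟨h22', h23'⟩, h81'⟩ := h D χ (le_trans (le_max_left _ _) hD) hq hp
  have key := h81' hA (a11 χ) (a21 χ) (adm72_a11 χ hlog) (adm72_a21 χ hlog)
  have e1 : (fun n => conj (a21 χ n)) = a11 χ := funext fun n => by rw [a21, Complex.conj_conj]
  have e2 : (fun n => conj (a11 χ n)) = a21 χ := funext fun n => rfl
  rw [e1, e2, ← xi11_eq_lhs81 χ hD8 hq h23' h22', Complex.add_conj, ← Complex.ofReal_sub,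
    Complex.norm_real, Real.norm_eq_abs] at key
  exact key

/-- **(9.1): "By Lemma 8.1, `Ξ₁₂ = 2Re{Θ₁(𝐚₁₂,𝐚₂₂)} + o(𝓟)`"** — the node `Eq91` FOLLOWS from
Prop. 2.2 (i), Lemma 2.3 and Lemma 8.1 (kernel-checked), as for (8.7).
[cite: Zhang2022LandauSiegel, §9 (9.1)] -/
theorem eq91_of (h22 : Prop22i) (h23 : Lemma23 c') (h81 : Lemma81 c') : Eq91 c' := by
  intro ε hε
  obtain ⟨D₀, h⟩ := (h22.and h23).and (h81 (‖iota3‖ + ‖iota4‖) ε hε)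
  refine ⟨max D₀ 8, fun D _ χ hD hq hp hA => ?_⟩
  have hD8 : 8 ≤ D := le_trans (le_max_right _ _) hD
  have hlog := two_le_log_of_eight_le hD8
  obtain ⟨⟨h22', h23'⟩, h81'⟩ := h D χ (le_trans (le_max_left _ _) hD) hq hp
  have key := h81' hA (a12 χ) (a22 χ) (adm72_a12 χ hlog) (adm72_a22 χ hlog)
  have e1 : (fun n => conj (a22 χ n)) = a12 χ := funext fun n => by rw [a22, Complex.conj_conj]
  have e2 : (fun n => conj (a12 χ n)) = a22 χ := funext fun n => rfl
  rw [e1, e2, ← xi12_eq_lhs81 χ hD8 hq h23' h22', Complex.add_conj, ← Complex.ofReal_sub,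
    Complex.norm_real, Real.norm_eq_abs] at key
  exact key

/-- `log D ≥ 5` once `D ≥ ⌈e⁵⌉`. [folklore] -/
private theorem five_le_log {D : ℕ} (hD : ⌈Real.exp 5⌉₊ ≤ D) : 5 ≤ Real.log D := by
  have h : Real.exp 5 ≤ D := le_trans (Nat.le_ceil _) (by exact_mod_cast hD)
  exact (Real.le_log_iff_exp_le (lt_of_lt_of_le (Real.exp_pos _) h)).mpr h

/-- `D ≥ 3` once `log D ≥ 2`. [folklore] -/
private theorem three_le_of_two_le_log {D : ℕ} (hD : 2 ≤ Real.log D) : 3 ≤ D := by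
  by_contra h
  rw [not_le] at h
  interval_cases D
  · simp at hD; linarith
  · simp at hD; linarith
  · have : Real.log (2 : ℕ) < 2 := by
      have h2 : Real.log 2 < 1 := by
        rw [Real.log_lt_iff_lt_exp (by norm_num)]
        exact lt_trans (by norm_num) Real.exp_one_gt_d9
      push_cast; linarith
    linarith

/-- At a modulus where Prop. 2.2 (i) holds (zeros on the line) and `𝓛 ≥ 5`: **`Ξ₁*` IS the sum of
the left sides of Lemma 8.1 at `(𝐚₁₁,𝐚₁₃)` and at `(𝐚₁₄,𝐚₂₂)`** — `H₁J̄₁ = A(𝐚₁₁;ρ)A(𝐚₁₃;1−ρ,ψ̄)`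
and `H̄₂J₂ = A(𝐚₁₄;ρ)A(𝐚₂₂;1−ρ,ψ̄)`. [cite: Zhang2022LandauSiegel, §10 (10.1)] -/
theorem xiStar1_eq_lhs81 {D : ℕ} [NeZero D] (χ : DirichletCharacter ℂ D) (hlog : 5 ≤ Real.log D)
    (hq : χ.IsQuadratic) (h22 : ∀ x ∈ PsiOne χ, ∀ s ∈ prodZeroSetOmega χ x, s.re = 1 / 2) :
    xiStar1 c' χ = lhs81 c' χ (a11 χ) (a13 χ) + lhs81 c' χ (a14 χ) (a22 χ) := by
  have hlog2 : 2 ≤ Real.log D := by linarith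
  rw [xiStar1, lhs81, lhs81, ← Finset.sum_add_distrib]
  refine Finset.sum_congr rfl fun i hi => ?_
  have mem : i.1 ∈ PsiOne χ ∧ i.2 ∈ zeroSet D i.1 := by
    rw [idx, Finset.mem_sigma] at hi
    exact ⟨mem_of_mem_finsetOf hi.1, mem_of_mem_finsetOf hi.2⟩
  have hre : i.2.re = 1 / 2 :=
    h22 i.1 mem.1 i.2 (mem_prodZeroSetOmega_of_mem_zeroSet χ mem.2)
  rw [Apoly_a11_eq_H1 χ i.1 hlog2, ApolyBar_a13_eq_conj_J1 χ i.1 hlog2 hq hre,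
    Apoly_a14_eq_J2 χ i.1 hlog, ApolyBar_a22_eq_conj_H2 χ i.1 hlog2 hq hre]
  ring

/-- At a modulus where Prop. 2.2 (i) and Lemma 2.3 hold: `Ξ_J`, as a complex number, IS the left side
of Lemma 8.1 at `(𝐚₂₃, 𝐚₂₃)` (`|J₁|² = A(𝐚₂₃;ρ)A(𝐚₂₃;1−ρ,ψ̄)`, `𝔠*`, `ω` real).
[cite: Zhang2022LandauSiegel, §18 (18.3)] -/
theorem xiJ_eq_lhs81 {D : ℕ} [NeZero D] (χ : DirichletCharacter ℂ D) (hlog : 2 ≤ Real.log D)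
    (hq : χ.IsQuadratic)
    (h23 : ∀ x ∈ PsiOne χ, ∀ ρ ∈ zeroSet D x, (cstar c' D x ρ).im = 0 ∧ 0 ≤ (cstar c' D x ρ).re)
    (h22 : ∀ x ∈ PsiOne χ, ∀ s ∈ prodZeroSetOmega χ x, s.re = 1 / 2) :
    (xiJ c' χ : ℂ) = lhs81 c' χ (a23 χ) (a23 χ) := by
  have hD3 : 3 ≤ D := three_le_of_two_le_log hlog
  rw [xiJ, lhs81, Complex.ofReal_sum]
  refine Finset.sum_congr rfl fun i hi => ?_
  have mem : i.1 ∈ PsiOne χ ∧ i.2 ∈ zeroSet D i.1 := by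
    rw [idx, Finset.mem_sigma] at hi
    exact ⟨mem_of_mem_finsetOf hi.1, mem_of_mem_finsetOf hi.2⟩
  have hre : i.2.re = 1 / 2 :=
    h22 i.1 mem.1 i.2 (mem_prodZeroSetOmega_of_mem_zeroSet χ mem.2)
  have hc := h23 i.1 mem.1 i.2 mem.2
  have hω := omegaW_re_pos hD3 hre
  have hcre : (((cstar c' D i.1 i.2).re : ℝ) : ℂ) = cstar c' D i.1 i.2 :=
    Complex.ext rfl (by simp [hc.1])
  have hωre : (((omegaW D i.2).re : ℝ) : ℂ) = omegaW D i.2 :=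
    Complex.ext rfl (by simp [hω.2])
  have hA : Apoly i.1 (a23 χ) i.2 = J1 χ i.1 i.2 := Apoly_a13_eq_J1 χ i.1 hlog i.2
  rw [hA, ApolyBar_a23_eq_conj_J1 χ i.1 hlog hq hre]
  have hsq := Complex.mul_conj' (J1 χ i.1 i.2)
  push_cast at hsq ⊢
  rw [hcre, hωre, ← hsq]
  ring

/-- **(10.1): "By Lemma 8.1, `Ξ₁* = Θ₁(𝐚₁₁,𝐚₁₃) + conj Θ₁(𝐚₁₃,𝐚₂₁) + Θ₁(𝐚₁₄,𝐚₂₂) +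
conj Θ₁(𝐚₁₂,𝐚₁₄) + o(𝓟)`"** — the node `Eq101` FOLLOWS from Prop. 2.2 (i), Lemma 2.3 and Lemma 8.1
(kernel-checked): Lemma 8.1 twice (`xiStar1_eq_lhs81`), with `conj 𝐚₁₃ = 𝐚₁₃`, `conj 𝐚₁₁ = 𝐚₂₁`,
`conj 𝐚₂₂ = 𝐚₁₂`, `conj 𝐚₁₄ = 𝐚₁₄`. [cite: Zhang2022LandauSiegel, §10 (10.1)] -/
theorem eq101_of (h22 : Prop22i) (h23 : Lemma23 c') (h81 : Lemma81 c') : Eq101 c' := by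
  intro ε hε
  have hε2 : 0 < ε / 2 := by positivity
  set B : ℝ := 1 + ‖iota2‖ + ‖iota3‖ + ‖iota4‖ with hB
  obtain ⟨D₀, h⟩ := (h22.and h23).and (h81 B (ε / 2) hε2)
  refine ⟨max D₀ ⌈Real.exp 5⌉₊, fun D _ χ hD hq hp hA => ?_⟩
  have hlog5 : 5 ≤ Real.log D := five_le_log (le_trans (le_max_right _ _) hD)
  have hlog2 : 2 ≤ Real.log D := by linarith
  obtain ⟨⟨h22', -⟩, h81'⟩ := h D χ (le_trans (le_max_left _ _) hD) hq hp
  have hι2 := norm_nonneg iota2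
  have hι3 := norm_nonneg iota3
  have hι4 := norm_nonneg iota4
  have k1 := h81' hA (a11 χ) (a13 χ) (adm72_mono (by rw [hB]; linarith) (adm72_a11 χ hlog2))
    (adm72_mono (by rw [hB]; linarith) (adm72_a13 χ hlog2))
  have k2 := h81' hA (a14 χ) (a22 χ) (adm72_mono (by rw [hB]; linarith) (adm72_a14 χ hlog5))
    (adm72_mono (by rw [hB]; linarith) (adm72_a22 χ hlog2))
  have e1 : (fun n => conj (a13 χ n)) = a13 χ := funext fun n => by
    rw [a13, map_mul, conj_apply_of_isQuadratic χ hq, Complex.conj_ofReal]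
  have e2 : (fun n => conj (a11 χ n)) = a21 χ := funext fun n => rfl
  have e3 : (fun n => conj (a22 χ n)) = a12 χ := funext fun n => by rw [a22, Complex.conj_conj]
  have e4 : (fun n => conj (a14 χ n)) = a14 χ := funext fun n => by
    rw [a14, map_mul, conj_apply_of_isQuadratic χ hq, Complex.conj_ofReal]
  rw [e1, e2] at k1
  rw [e3, e4] at k2
  rw [xiStar1_eq_lhs81 χ hlog5 hq h22']
  have halg : lhs81 c' χ (a11 χ) (a13 χ) + lhs81 c' χ (a14 χ) (a22 χ) -
      (Theta1 c' χ (a11 χ) (a13 χ) + conj (Theta1 c' χ (a13 χ) (a21 χ)) +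
        Theta1 c' χ (a14 χ) (a22 χ) + conj (Theta1 c' χ (a12 χ) (a14 χ))) =
      (lhs81 c' χ (a11 χ) (a13 χ) -
        (Theta1 c' χ (a11 χ) (a13 χ) + conj (Theta1 c' χ (a13 χ) (a21 χ)))) +
      (lhs81 c' χ (a14 χ) (a22 χ) -
        (Theta1 c' χ (a14 χ) (a22 χ) + conj (Theta1 c' χ (a12 χ) (a14 χ)))) := by ring
  rw [halg]
  refine (norm_add_le _ _).trans ?_
  linarith

/-- **(18.3): "By Lemma 8.1, `ΣΣ𝔠*|J₁(ρ,ψ)|²ω(ρ) = 2Re{Θ₁(𝐚₂₃,𝐚₂₃)} + o(𝓟)`"** — the node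
`Eq183` FOLLOWS from Prop. 2.2 (i), Lemma 2.3 and Lemma 8.1 (kernel-checked).
[cite: Zhang2022LandauSiegel, §18 (18.3)] -/
theorem eq183_of (h22 : Prop22i) (h23 : Lemma23 c') (h81 : Lemma81 c') : Eq183 c' := by
  intro ε hε
  obtain ⟨D₀, h⟩ := (h22.and h23).and (h81 1 ε hε)
  refine ⟨max D₀ ⌈Real.exp 5⌉₊, fun D _ χ hD hq hp hA => ?_⟩
  have hlog5 : 5 ≤ Real.log D := five_le_log (le_trans (le_max_right _ _) hD)
  have hlog2 : 2 ≤ Real.log D := by linarith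
  obtain ⟨⟨h22', h23'⟩, h81'⟩ := h D χ (le_trans (le_max_left _ _) hD) hq hp
  have key := h81' hA (a23 χ) (a23 χ) (adm72_a23 χ hlog2) (adm72_a23 χ hlog2)
  have e1 : (fun n => conj (a23 χ n)) = a23 χ := funext fun n => by
    show conj (a13 χ n) = a13 χ n
    rw [a13, map_mul, conj_apply_of_isQuadratic χ hq, Complex.conj_ofReal]
  rw [e1, ← xiJ_eq_lhs81 χ hlog2 hq h23' h22', Complex.add_conj, ← Complex.ofReal_sub,
    Complex.norm_real, Real.norm_eq_abs] at key
  exact key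

end Reductions

end Literature.NumberTheory.LFunctions.Zhang2022.Skeleton
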